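import Summits.QuantumFields.YangMills.Theorems.UnitScaleTiltProp7SymAvgTwFrameDiff
import HarnessLib

/-!
# Route `UnitScaleTilt`, crux «MinimiserStabilityRegPr» (stmt-QuantumFields-19200), route-R E′ (A′)-comb, open flat lemma «COMB-FLAT COERCIVITY» (★★OWNER RULING g29-№17 (2)),
# brick (I2) of ★px6 g5's LOCATE-COMBFLAT §7 «σ EXPLICIT»: **THE FLAT FRAME RESPONSE FORMULA** — the derivative at `A = 0` of the accumulated comb frames
# `A ↦ w_A(y) = \overline{R_{0,y}e^{A}}^{(k)}` ([Balaban1985Averaging] (85)∕(97)∕(160)) AT THE FLAT BACKGROUND `U₀ = 1`, in a GENERAL direction `X`: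
# `r(1) X (y) = Σ_{j<k} F̂(L^{k−j}·ŷ)[Q_j(1)X]` — the block means (111)–(112) of the tree-contour sums of the iterated linear averages (125)∕(127) — with its sup row

Cell `ym3-torus` (HUMAN RULING D-0037, YM ladder rung R3 — YM₃ on T³ is a rung, NOT d = 4, NOT infinite volume, NOT a mass gap, NOT Clay; YM gap NOT proved), width seat
`ym3-torus-px21` (gen 6; FILL-TO-CAP «width 21»).  THEOREMS ONLY (0 `def`, 0 `sorry`); `--supports stmt-QuantumFields-19200 --as helper`; count-neutral.  Nothing here is a claim
about the stub, the crux or any summit statement.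

THE PRINT.  [Balaban1985Averaging] p. 42, (160): *«v_k(x) = (\overline{R_{0,x}U′})(\overline{R̄_{0,x}U̿′})·…·(\overline{R̄^{k−1}_{0,x}U̿′^{k−1}}), x ∈ Ω^{(k)}»*, (163): *«|v_k(x) − 1| <
O(1)α₁ Σ_{j=0}^{k−1} L^{j+1}η ≤ O(1)α₁»*; p. 34, (110)–(112): `v(y) = exp F(y)`, `F̂(y) = Σ_{x∈B(y)} L^{−d} A(Γ_{y,x})`; pp. 36–38, (125)∕(127)∕(130): the iterated linear parts
`L^jη·Q_j(1)A`.  Print gives the BOUND (163) for `v_k − 1`; the LINEAR PART of `v_k` in `A′` is not displayed there — this file writes it out and proves it, at `U₀ = 1`.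
WHY (bus 2026-08-29 03:33–03:58Z).  RULING №17 (2) records the open flat lemma COMB-FLAT COERCIVITY for the comb averaging `QTw`; ★px6 g5's LOCATE (19200 evidence #60) reduces it
to (I1) `Rc 1 = RS 1` (px6's pen — NOT touched here) and (I3) «Coulomb of the comb», whose object is `σ = Λ + r(1)`, `r(1) := d(frameTw 1)₀` (✓`Prop7SymAvgTwBridge.QTw_eq_QSym_sub`:
`QTw = QSym − D_{Ū₀}∘r`); the tree had `r` only by analyticity (✓`Prop7SymAvgTwFrameDiff`: «no explicit formula or bound for `r`»).  Item (I2) «σ explicit» of that LOCATE is this file.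

WHAT IS PROVED (ns `…Theorems.Prop7FlatFrameResponse`; lit letters of `B7Prop1Explicit`∕`B7Prop3Flat`∕`B7Prop4Flat`∕`B7Prop6Flat`: `Site d = ℤᵈ`, `expCfg`, the block-frame exponent
`Favg` and its linearisation `Fhat` (110)–(112), the iterated linear average `linQIter` (127), the accumulated frames `vprod` (160) and their `Q`-form `vprodQ`; `𝔸` any complete normed
`ℂ`-algebra; `L ≥ 2`).
* §0 bookkeeping: `Fhat_sub`, `Fhat_csmul`, `norm_Fhat_le_of_bound` (`‖F̂(q)[C]‖ ≤ dL·sup‖C‖`), `vframe_unitCfg` (`v[1] = 1`), `vprodQ_zero_field` (`w_j(0) = 1`).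
* §1 ★★ `hasDerivAt_vframe_logIter` — ONE FACTOR OF (160): `t ↦ v(q)[e^{Q_j(1, tB)}]` has derivative `F̂(q)[L^j·Q_j(1)B]` at `t = 0` (from the quantitative (112) ✓`frame_estimate`
  — `‖v − 1 − F̂[C]‖ ≤ 33θ²` — at `C := Q_j(1,tB)`, and Prop. 4's (130) ✓`prop4_flat_induction` — `‖Q_j(1,tB) − t·L^jQ_j(1)B‖ ≤ 8C₁(L^j|t|b)²`; an `O(|t|²)` remainder).
* §2 ★★★ `hasDerivAt_vprodQ_smul`, ★★★ `hasDerivAt_vprod_expCfg_smul` — THE FORMULA: for every bounded bond field `B` on `ℤᵈ`, every `k`, `z`,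
  `HasDerivAt (t ↦ ↑(vprod L (expCfg (t • B)) k z)) (Σ_{j<k} Fhat L (linQIter L B j) ((L:ℤ)^(k−j) • z)) 0` (induction on (160) with the product rule at factors `= 1`;
  `vprod = vprodQ` near `t = 0` by ✓`vprod_eq_vprodQ`).
* §3 ★ `norm_frameResponse_le` — THE SUP ROW, (163)'s linear shadow: `‖Σ_{j<k} F̂(L^{k−j}z)[L^jQ_j(1)B]‖ ≤ dL·(Σ_{j<k} L^j)·sup‖B‖ ≤ 2d·L^k·sup‖B‖`.
* §4 AT THE T³ MEMBER (`F : T3Family`, `n ≤ K`, `k = K − n`; ✓`Prop7SymAvgTw.frameTw`): `frameTw_one_eq_vprod` (`frameTw 1 A y = vprod L (expCfg A♯) (K−n) (coordT3 y)`, `A♯ z κ = A⟨x₀+z, κ⟩`),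
  ★★ `differentiableAt_frameTw_one` ∕ `hasFDerivAt_frameTw_one` (NO regularity hypothesis — the flat background), ★★★ `fderiv_frameTw_one_apply` —
  `fderiv ℂ (A ↦ ↑(frameTw F n K h 1 A y)) 0 X = Σ_{j<K−n} Fhat L (linQIter L X♯ j) ((L:ℤ)^(K−n−j) • coordT3 y)`, and ★ `norm_fderiv_frameTw_one_apply_le` (`≤ 2·d·L^{K−n}·‖X‖`, `d = 3`).
HONEST SCOPE.  Flat background only; pure calculus over lit-balaban's kernel-checked Props. 3∕4∕6-flat files; the gauge-direction corollary `r(1)(Dλ) = λ∘x̂ − Q′_{K−n}λ` is ★px6 g5's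
(I1) file (`…CombFramesFlatGaugeDir`) and is NOT stated here; nothing of (I3), COMB-FLAT COERCIVITY, N06, EX, the crux; nothing continuum ∕ OS ∕ mass-gap ∕ Clay.

References: T. Bałaban, CMP **98** (1985) 17–51 [Balaban1985Averaging] ((9) p.18, (85) p.31, (97)–(99) p.32, (110)–(112) p.34, (125)–(127) pp.36–37, (130)–(131) p.38, (159)–(163) p.42);
CMP **99** (1985) 389–434 [Balaban1985BackgroundPropagators] ((3.14) p.393); CMP **102** (1985) 277–309 [Balaban1985Variational] ((44) p.285).
-/

set_option autoImplicit false

noncomputable section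

open scoped Matrix.Norms.L2Operator Topology BigOperators

namespace Summit.QuantumFields.YangMills.Theorems.Prop7FlatFrameResponse

open NormedSpace Metric Set Filter Asymptotics Finset
open Literature.MathematicalPhysics.QuantumFieldTheory.Balaban1983to89
open Literature.MathematicalPhysics.QuantumFieldTheory.Balaban1983to89.T3ContinuumYM3Torus
open T3SectALandauChart (bgUnits bgUnits_one)
open B7Prop1Explicit renaming Site → LSite
open B7Prop1Explicit (expUnit val_expUnit e Letter hol stepHol asum stepA boxVec treeWord l1 length_treeWord l1_boxVec_le norm_asum_le norm_avg_le)
open B7Prop3Flat (expCfg Favg Fhat vframe frame_estimate asum_csmul C1)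
open B7Prop4Flat (linQIter logIter linQIter_csmul prop4_flat_induction asum_sub C1_pos logIter_zero_field norm_linQIter_le)
open B7Prop6Flat (vprod vprodQ vprodQ_succ vprod_eq_vprodQ analyticAt_vprodQ)
open B7Eq99Concrete (wrec wrec_one_left)
open B10Eq27TorusAxialLog (pull transl)
open Summit.QuantumFields.YangMills.Theorems.Prop7SPrint (basePt)
open Summit.QuantumFields.YangMills.Theorems.Prop7SymAvgTw (coordT3 frameTw)
open Summit.QuantumFields.YangMills.Theorems.Prop7SymAvgTwFrameDiff (pull_expUnit_eq_expCfg norm_pullExp_le)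

/-! ## §0 Bookkeeping on the lit letters -/

section Lit

variable {d : ℕ} {𝔸 : Type*} [NormedRing 𝔸] [NormedAlgebra ℂ 𝔸] [CompleteSpace 𝔸]

omit [CompleteSpace 𝔸] in
/-- `F̂` is additive: `F̂[C − C′] = F̂[C] − F̂[C′]` (finite sum of contour sums). [cite: Balaban1985Averaging, (112) p.34] -/
theorem Fhat_sub (L : ℕ) (C C' : LSite d → Fin d → 𝔸) (q : LSite d) :
    Fhat L (C - C') q = Fhat L C q - Fhat L C' q := by
  simp only [Fhat, asum_sub, smul_sub, Finset.sum_sub_distrib]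

omit [CompleteSpace 𝔸] in
/-- `F̂` is `ℂ`-homogeneous: `F̂[t•C] = t•F̂[C]`. [cite: Balaban1985Averaging, (112) p.34] -/
theorem Fhat_csmul (L : ℕ) (t : ℂ) (C : LSite d → Fin d → 𝔸) (q : LSite d) :
    Fhat L (t • C) q = t • Fhat L C q := by
  simp only [Fhat, asum_csmul, Finset.smul_sum, smul_comm t]

omit [CompleteSpace 𝔸] in
/-- **`‖F̂(q)[C]‖ ≤ dL · sup_b ‖C_b‖`**: each tree contour `Γ_{q,q+r}`, `r ∈ [0,L)ᵈ`, has at most `dL` bonds and the weights `L^{−d}` are a probability vector.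
[cite: Balaban1985Averaging, (112) p.34, (35) p.23] -/
theorem norm_Fhat_le_of_bound (L : ℕ) (hL : 1 ≤ L) (C : LSite d → Fin d → 𝔸) {c : ℝ} (hc : 0 ≤ c) (hC : ∀ x κ, ‖C x κ‖ ≤ c) (q : LSite d) :
    ‖Fhat L C q‖ ≤ ((d * L : ℕ) : ℝ) * c := by
  unfold Fhat
  refine norm_avg_le L hL _ fun r => ?_
  have hlen : (treeWord (boxVec L r)).length ≤ d * L := by
    rw [length_treeWord]; exact l1_boxVec_le L r
  have hfit : l1 (q - q) + (treeWord (boxVec L r)).length ≤ d * L := by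
    rw [sub_self]
    have h0 : l1 (0 : LSite d) = 0 := by simp only [l1, Pi.zero_apply, Int.natAbs_zero, Finset.sum_const_zero]
    rw [h0, zero_add]; exact hlen
  have h := norm_asum_le C q (d * L) hc (fun x κ _ => hC x κ) (treeWord (boxVec L r)) q hfit
  refine h.trans ?_
  exact mul_le_mul_of_nonneg_right (by exact_mod_cast hlen) hc

omit [NormedAlgebra ℂ 𝔸] [CompleteSpace 𝔸] in
/-- Parallel transport of the unit configuration is `1`. [folklore] -/
theorem hol_unitCfg : ∀ (x : LSite d) (w : List (Letter d)), hol (1 : LSite d → Fin d → 𝔸ˣ) x w = 1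
  | x, [] => rfl
  | x, l :: w => by
    rw [B7Prop1Explicit.hol_cons, hol_unitCfg (x + l.vec) w, mul_one]
    obtain ⟨μ, b⟩ := l
    cases b <;> simp [B7Prop1Explicit.stepHol_false, B7Prop1Explicit.stepHol_true]

/-- The block frame (110) of the unit configuration is `1` (`F(q)[1] = 0`). [cite: Balaban1985Averaging, (110) p.34] -/
theorem vframe_unitCfg (L : ℕ) (q : LSite d) : vframe L (1 : LSite d → Fin d → 𝔸ˣ) q = 1 := by
  apply Units.ext
  rw [vframe, val_expUnit, Units.val_one]
  have hF : Favg L (1 : LSite d → Fin d → 𝔸ˣ) q = 0 := by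
    unfold Favg
    refine Finset.sum_eq_zero fun r _ => ?_
    rw [hol_unitCfg, Units.val_one, MatrixLog.mlog_one, smul_zero]
  rw [hF, exp_zero]

/-- At `B = 0` every accumulated frame in `Q`-form is `1` (`Q_j(1, 0) = 0`, `e^0 = 1`, `v[1] = 1`). [cite: Balaban1985Averaging, (160) p.42] -/
theorem vprodQ_zero_field (L : ℕ) (hL : 1 ≤ L) : ∀ (j : ℕ) (z : LSite d), vprodQ L (0 : LSite d → Fin d → 𝔸) j z = 1
  | 0, z => rfl
  | j + 1, z => by
    rw [vprodQ_succ, vprodQ_zero_field L hL j, logIter_zero_field L hL j, B7Prop3GeneralRotated.expCfg_zero, vframe_unitCfg, one_mul]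

/-! ## §1 One factor of (160): the derivative of the block frame of the `j`-th double-bar average -/

/-- ★★ **ONE FACTOR OF (160), LINEARISED**: for a bounded bond field `B` (`‖B_b‖ ≤ b`), `L ≥ 2`, the block frame `v(q)[U̿′^j]` of the `j`-th double-bar average of `U′ = e^{tB}` — in
`Q`-form, `v(q)[e^{Q_j(1,tB)}]` — has `t`-derivative `F̂(q)[L^j·Q_j(1)B]` at `t = 0`: by (112) `‖v − 1 − F̂[C]‖ ≤ 33θ²` at `C = Q_j(1,tB)` (`θ = dL·2L^j b|t|`, (161)) and (130)
`‖Q_j(1,tB) − t·L^jQ_j(1)B‖ ≤ 8C₁(L^j b|t|)²`, the remainder is `O(|t|²)`. [cite: Balaban1985Averaging, (110)–(112) p.34, (130)–(131) p.38, (161) p.42] -/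
theorem hasDerivAt_vframe_logIter (L : ℕ) (hL : 2 ≤ L) (B : LSite d → Fin d → 𝔸) {b : ℝ} (hb : 0 ≤ b) (hB : ∀ x κ, ‖B x κ‖ ≤ b)
    (j : ℕ) (q : LSite d) :
    HasDerivAt (fun t : ℂ => ((vframe L (expCfg (logIter L (t • B) j)) q : 𝔸ˣ) : 𝔸)) (Fhat L (linQIter L B j) q) 0 := by
  have hL1 : 1 ≤ L := le_trans (by norm_num) hL
  have hC1 := C1_pos d
  set M : ℝ := (L : ℝ) ^ j * b with hM
  have hM0 : 0 ≤ M := by positivity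
  set D : ℝ := ((d * L : ℕ) : ℝ) with hD
  have hD0 : 0 ≤ D := by positivity
  -- the value at `t = 0` is `1`
  have h0 : ((vframe L (expCfg (logIter L ((0 : ℂ) • B) j)) q : 𝔸ˣ) : 𝔸) = 1 := by
    rw [zero_smul, logIter_zero_field L hL1 j, B7Prop3GeneralRotated.expCfg_zero, vframe_unitCfg, Units.val_one]
  rw [hasDerivAt_iff_isLittleO_nhds_zero]
  simp only [zero_add, h0]
  -- the constant of the quadratic remainder
  set Cq : ℝ := 33 * (D * (2 * M)) ^ 2 + D * (8 * C1 d * M ^ 2) with hCq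
  refine (Asymptotics.IsBigO.of_bound Cq ?_).trans_isLittleO (Asymptotics.isLittleO_pow_id (one_lt_two))
  -- the radius inside which Prop. 4's smallness and `θ ≤ 1/64` hold
  set ρ : ℝ := 1 / ((8 * C1 d + 128 * D + 1) * (M + 1)) with hρ
  have hρ0 : 0 < ρ := by rw [hρ]; positivity
  rw [Metric.eventually_nhds_iff]
  refine ⟨ρ, hρ0, fun t ht => ?_⟩
  rw [dist_zero_right] at ht
  have ht0 : 0 ≤ ‖t‖ := norm_nonneg t
  -- `(8C₁ + 128D + 1)(M+1)‖t‖ ≤ 1`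
  have hprod : (8 * C1 d + 128 * D + 1) * (M + 1) * ‖t‖ ≤ 1 := by
    have hpos : 0 < (8 * C1 d + 128 * D + 1) * (M + 1) := by positivity
    have := mul_le_mul_of_nonneg_left ht.le hpos.le
    rwa [hρ, mul_one_div_cancel hpos.ne'] at this
  have hsmall : 8 * C1 d * ((L : ℝ) ^ j * (‖t‖ * b)) ≤ 1 := by
    have h1 : 8 * C1 d * ((L : ℝ) ^ j * (‖t‖ * b)) = 8 * C1 d * M * ‖t‖ := by rw [hM]; ring
    rw [h1]
    nlinarith [hC1.le, hM0, hD0, ht0, mul_nonneg hM0 ht0, mul_nonneg hD0 (mul_nonneg hM0 ht0), mul_nonneg hC1.le ht0]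
  have hθ1 : D * (2 * ((L : ℝ) ^ j * (‖t‖ * b))) ≤ 1 / 64 := by
    have h1 : D * (2 * ((L : ℝ) ^ j * (‖t‖ * b))) = 2 * D * M * ‖t‖ := by rw [hM]; ring
    rw [h1]
    nlinarith [hC1.le, hM0, hD0, ht0, mul_nonneg hM0 ht0, mul_nonneg hC1.le (mul_nonneg hM0 ht0), mul_nonneg hC1.le ht0]
  -- Prop. 4 at `tB`: (130) and (131)
  have htB : ∀ x κ, ‖(t • B) x κ‖ ≤ ‖t‖ * b := fun x κ => by
    rw [Pi.smul_apply, Pi.smul_apply, norm_smul]; exact mul_le_mul_of_nonneg_left (hB x κ) ht0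
  obtain ⟨-, h130, h131⟩ := prop4_flat_induction L hL (t • B) (by positivity) htB j hsmall j le_rfl
  -- (112) at `V := e^{Q_j(1,tB)}`, `A := Q_j(1,tB)`, `θ := D·2L^j‖t‖b`
  set θ : ℝ := D * (2 * ((L : ℝ) ^ j * (‖t‖ * b))) with hθ
  have hθ0 : 0 ≤ θ := by positivity
  have hVA : ∀ x κ, l1 (x - q) ≤ d * L → ((expCfg (logIter L (t • B) j) x κ : 𝔸ˣ) : 𝔸) = exp (logIter L (t • B) j x κ) ∧
      ‖logIter L (t • B) j x κ‖ ≤ 2 * ((L : ℝ) ^ j * (‖t‖ * b)) := fun x κ _ => ⟨rfl, h131 x κ⟩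
  obtain ⟨-, -, -, -, h112, -, -⟩ := frame_estimate (expCfg (logIter L (t • B) j)) (logIter L (t • B) j) q (d * L) (by positivity) hVA L hL1 q
    (by simp [l1]) (le_of_eq hθ.symm) hθ0 hθ1
  -- the linear defect `F̂[Q_j(1,tB) − t·L^jQ_j(1)B]`
  have hlin : Fhat L (logIter L (t • B) j) q - t • Fhat L (linQIter L B j) q = Fhat L (logIter L (t • B) j - linQIter L (t • B) j) q := by
    have hcs : linQIter L (t • B) j = t • linQIter L B j := funext fun z => funext fun κ => linQIter_csmul L t B j z κ
    rw [Fhat_sub, hcs, Fhat_csmul]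
  have hdef : ‖Fhat L (logIter L (t • B) j - linQIter L (t • B) j) q‖ ≤ D * (8 * C1 d * ((L : ℝ) ^ j * (‖t‖ * b)) ^ 2) :=
    norm_Fhat_le_of_bound L hL1 _ (by positivity) (fun x κ => by rw [Pi.sub_apply, Pi.sub_apply]; exact h130 x κ) q
  -- assemble
  rw [norm_pow]
  calc ‖((vframe L (expCfg (logIter L (t • B) j)) q : 𝔸ˣ) : 𝔸) - 1 - t • Fhat L (linQIter L B j) q‖
      = ‖(((vframe L (expCfg (logIter L (t • B) j)) q : 𝔸ˣ) : 𝔸) - 1 - Fhat L (logIter L (t • B) j) q)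
          + (Fhat L (logIter L (t • B) j) q - t • Fhat L (linQIter L B j) q)‖ := by rw [sub_add_sub_cancel]
    _ ≤ ‖((vframe L (expCfg (logIter L (t • B) j)) q : 𝔸ˣ) : 𝔸) - 1 - Fhat L (logIter L (t • B) j) q‖
          + ‖Fhat L (logIter L (t • B) j) q - t • Fhat L (linQIter L B j) q‖ := norm_add_le _ _
    _ ≤ 33 * θ ^ 2 + D * (8 * C1 d * ((L : ℝ) ^ j * (‖t‖ * b)) ^ 2) := add_le_add h112 (by rw [hlin]; exact hdef)
    _ = Cq * ‖t‖ ^ 2 := by rw [hCq, hθ, hM]; ring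

/-! ## §2 ★★★ THE FLAT FRAME RESPONSE FORMULA — the derivative of (160) at `A′ = 0` -/

/-- ★★★ **THE ACCUMULATED FRAMES IN `Q`-FORM, LINEARISED AT `0`**: `t ↦ w_k(tB)(z)` has derivative `Σ_{j<k} F̂(L^{k−j}z)[L^jQ_j(1)B]` at `t = 0` — induction on
`w_{j+1}(z) = w_j(Lz)·v(Lz)[e^{Q_j}]` with the product rule at factors `= 1` (`vprodQ_zero_field`) and §1. [cite: Balaban1985Averaging, (160) p.42, (110)–(112) p.34, (127) p.37] -/
theorem hasDerivAt_vprodQ_smul (L : ℕ) (hL : 2 ≤ L) (B : LSite d → Fin d → 𝔸) {b : ℝ} (hb : 0 ≤ b) (hB : ∀ x κ, ‖B x κ‖ ≤ b) :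
    ∀ (k : ℕ) (z : LSite d), HasDerivAt (fun t : ℂ => ((vprodQ L (t • B) k z : 𝔸ˣ) : 𝔸))
      (∑ j ∈ Finset.range k, Fhat L (linQIter L B j) (((L : ℤ) ^ (k - j)) • z)) 0
  | 0, z => by
    simp only [B7Prop6Flat.vprodQ_zero, Units.val_one, Finset.range_zero, Finset.sum_empty]
    exact hasDerivAt_const (0 : ℂ) (1 : 𝔸)
  | k + 1, z => by
    have hL1 : 1 ≤ L := le_trans (by norm_num) hL
    have ih := hasDerivAt_vprodQ_smul L hL B hb hB k ((L : ℤ) • z)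
    have hv := hasDerivAt_vframe_logIter L hL B hb hB k ((L : ℤ) • z)
    have hmul := ih.mul hv
    -- values at `t = 0` are `1`
    have h1 : ((vprodQ L ((0 : ℂ) • B) k ((L : ℤ) • z) : 𝔸ˣ) : 𝔸) = 1 := by
      rw [zero_smul, vprodQ_zero_field L hL1, Units.val_one]
    have h2 : ((vframe L (expCfg (logIter L ((0 : ℂ) • B) k)) ((L : ℤ) • z) : 𝔸ˣ) : 𝔸) = 1 := by
      rw [zero_smul, logIter_zero_field L hL1 k, B7Prop3GeneralRotated.expCfg_zero, vframe_unitCfg, Units.val_one]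
    rw [h1, h2, mul_one, one_mul] at hmul
    have hfun : (fun t : ℂ => ((vprodQ L (t • B) (k + 1) z : 𝔸ˣ) : 𝔸))
        = fun t : ℂ => ((vprodQ L (t • B) k ((L : ℤ) • z) : 𝔸ˣ) : 𝔸) * ((vframe L (expCfg (logIter L (t • B) k)) ((L : ℤ) • z) : 𝔸ˣ) : 𝔸) := by
      funext t; rw [vprodQ_succ, Units.val_mul]
    rw [hfun]
    refine hmul.congr_deriv ?_
    rw [Finset.sum_range_succ, Nat.add_sub_cancel_left, pow_one]
    congr 1
    refine Finset.sum_congr rfl fun j hj => ?_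
    rw [Finset.mem_range] at hj
    rw [smul_smul, ← pow_succ, show k - j + 1 = k + 1 - j by omega]

/-- ★★★ **THE FLAT FRAME RESPONSE FORMULA** — the derivative of the accumulated comb frames (160) `v_k(z)[e^{tB}]` at `t = 0`, for EVERY bounded bond field `B` on `ℤᵈ` (`L ≥ 2`):
`(d/dt)|₀ v_k(z)[e^{tB}] = Σ_{j<k} F̂(L^{k−j}·z)[L^j·Q_j(1)B]` — the sum over the levels `j < k` of the block means, over the level-`(j+1)` block cornered at the image `L^{k−j}z` of `z`, of the
tree-contour sums of the `j`-fold linear average of `B` (near `t = 0`, `v_k = w_k` by ✓`vprod_eq_vprodQ`). [cite: Balaban1985Averaging, (160)–(163) p.42, (110)–(112) p.34, (125)–(127) pp.36–37] -/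
theorem hasDerivAt_vprod_expCfg_smul (L : ℕ) (hL : 2 ≤ L) (B : LSite d → Fin d → 𝔸) {b : ℝ} (hb : 0 ≤ b) (hB : ∀ x κ, ‖B x κ‖ ≤ b)
    (k : ℕ) (z : LSite d) :
    HasDerivAt (fun t : ℂ => ((vprod L (expCfg (t • B)) k z : 𝔸ˣ) : 𝔸))
      (∑ j ∈ Finset.range k, Fhat L (linQIter L B j) (((L : ℤ) ^ (k - j)) • z)) 0 := by
  have hC1 := C1_pos d
  refine (hasDerivAt_vprodQ_smul L hL B hb hB k z).congr_of_eventuallyEq ?_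
  -- near `0`, Prop. 4's smallness `8C₁L^k‖t‖b ≤ 1` holds, so `v_k = w_k`
  set ρ : ℝ := 1 / ((8 * C1 d + 1) * ((L : ℝ) ^ k * b + 1)) with hρ
  have hρ0 : 0 < ρ := by rw [hρ]; positivity
  rw [Filter.EventuallyEq, Metric.eventually_nhds_iff]
  refine ⟨ρ, hρ0, fun t ht => ?_⟩
  rw [dist_zero_right] at ht
  have ht0 : 0 ≤ ‖t‖ := norm_nonneg t
  have hM0 : 0 ≤ (L : ℝ) ^ k * b := by positivity
  have hprod : (8 * C1 d + 1) * ((L : ℝ) ^ k * b + 1) * ‖t‖ ≤ 1 := by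
    have hpos : 0 < (8 * C1 d + 1) * ((L : ℝ) ^ k * b + 1) := by positivity
    have := mul_le_mul_of_nonneg_left ht.le hpos.le
    rwa [hρ, mul_one_div_cancel hpos.ne'] at this
  have hsmall : 8 * C1 d * ((L : ℝ) ^ k * (‖t‖ * b)) ≤ 1 := by
    have h1 : 8 * C1 d * ((L : ℝ) ^ k * (‖t‖ * b)) = 8 * C1 d * ((L : ℝ) ^ k * b) * ‖t‖ := by ring
    rw [h1]
    nlinarith [hC1.le, hM0, ht0, mul_nonneg hM0 ht0, mul_nonneg hC1.le ht0]
  have htB : ∀ x κ, ‖(t • B) x κ‖ ≤ ‖t‖ * b := fun x κ => by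
    rw [Pi.smul_apply, Pi.smul_apply, norm_smul]; exact mul_le_mul_of_nonneg_left (hB x κ) ht0
  show ((vprod L (expCfg (t • B)) k z : 𝔸ˣ) : 𝔸) = ((vprodQ L (t • B) k z : 𝔸ˣ) : 𝔸)
  rw [vprod_eq_vprodQ L hL (t • B) (by positivity) htB k hsmall k le_rfl]

/-! ## §3 The sup row — (163)'s linear shadow -/

omit [CompleteSpace 𝔸] in
/-- ★ **THE SUP ROW OF THE FLAT FRAME RESPONSE**: `‖Σ_{j<k} F̂(L^{k−j}z)[L^jQ_j(1)B]‖ ≤ dL·(Σ_{j<k} L^j)·b ≤ 2d·L^k·b` for `sup_b‖B_b‖ ≤ b` — (126)∕(131) `‖L^jQ_j(1)B‖ ≤ L^j b` and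
`‖F̂‖ ≤ dL·sup`; the geometric sum `L·Σ_{j<k}L^j = (L^{k+1} − L)∕(L − 1) ≤ 2L^k` for `L ≥ 2` — print's «O(1)α₁Σ_{j<k}L^{j+1}η ≤ O(1)α₁» of (163).
[cite: Balaban1985Averaging, (163) p.42, (126) p.36, (131) p.38] -/
theorem norm_frameResponse_le (L : ℕ) (hL : 2 ≤ L) (B : LSite d → Fin d → 𝔸) {b : ℝ} (hb : 0 ≤ b) (hB : ∀ x κ, ‖B x κ‖ ≤ b)
    (k : ℕ) (z : LSite d) :
    ‖∑ j ∈ Finset.range k, Fhat L (linQIter L B j) (((L : ℤ) ^ (k - j)) • z)‖ ≤ 2 * d * (L : ℝ) ^ k * b := by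
  have hL1 : 1 ≤ L := le_trans (by norm_num) hL
  have hLr : (2 : ℝ) ≤ L := by exact_mod_cast hL
  -- termwise: `‖F̂(·)[L^jQ_jB]‖ ≤ dL · L^j b`
  have hterm : ∀ j ∈ Finset.range k, ‖Fhat L (linQIter L B j) (((L : ℤ) ^ (k - j)) • z)‖ ≤ ((d * L : ℕ) : ℝ) * ((L : ℝ) ^ j * b) :=
    fun j _ => norm_Fhat_le_of_bound L hL1 _ (by positivity) (norm_linQIter_le L hL1 B hb hB j) _
  refine (norm_sum_le _ _).trans ((Finset.sum_le_sum hterm).trans ?_)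
  rw [← Finset.mul_sum, ← Finset.sum_mul]
  -- the geometric sum `Σ_{j<k} L^j ≤ 2 L^k / L` in the form `L · Σ_{j<k} L^j ≤ 2 · L^k`
  have hgeom : (L : ℝ) * ∑ j ∈ Finset.range k, (L : ℝ) ^ j ≤ 2 * (L : ℝ) ^ k := by
    have hx : (1 : ℝ) < L := by linarith
    have hsum : ∑ j ∈ Finset.range k, (L : ℝ) ^ j = ((L : ℝ) ^ k - 1) / ((L : ℝ) - 1) := geom_sum_eq hx.ne' k
    have hL1' : 0 < (L : ℝ) - 1 := by linarith
    rw [hsum, mul_div_assoc', div_le_iff₀ hL1']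
    have hLk : 1 ≤ (L : ℝ) ^ k := one_le_pow₀ hx.le
    nlinarith
  push_cast
  calc (d : ℝ) * (L : ℝ) * ((∑ j ∈ Finset.range k, (L : ℝ) ^ j) * b)
      = (d : ℝ) * b * ((L : ℝ) * ∑ j ∈ Finset.range k, (L : ℝ) ^ j) := by ring
    _ ≤ (d : ℝ) * b * (2 * (L : ℝ) ^ k) := mul_le_mul_of_nonneg_left hgeom (by positivity)
    _ = 2 * d * (L : ℝ) ^ k * b := by ring

end Lit

/-! ## §4 At the T³ member: `r(1) = d(frameTw 1)₀` explicit -/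

section Member

variable (F : T3Family) {n K : ℕ} (h : n ≤ K)

/-- **`frameTw 1 A y = v_{K−n}(ŷ)[e^{A♯}]`** — at the flat background the frame of the twisted chart of record IS lit-balaban's flat accumulated frame (160) `B7Prop6Flat.vprod` at the
pulled-back exponent `A♯ z κ = A⟨x₀ + z, κ⟩` and the canonical coordinates `ŷ = coordT3 y` (✓`wrec_one_left`, `bgUnits 1 = 1`). [cite: Balaban1985Averaging, (85) p.31, (160) p.42] -/
theorem frameTw_one_eq_vprod (A : PBond (F.P K) 0 → Matrix (Fin 2) (Fin 2) ℂ) (y : Site (F.P n) 0) :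
    frameTw F n K h 1 A y = vprod (F.P K).L (expCfg (fun z κ => A ⟨transl (basePt F n K) z, κ⟩)) (K - n) (coordT3 F n K h y) := by
  rw [Prop7SymAvgTw.frameTw_def, ← pull_expUnit_eq_expCfg]
  have h1 : pull (bgUnits F K (1 : GaugeField (F.P K) 0 (Matrix.specialUnitaryGroup (Fin 2) ℂ))) (basePt F n K)
      = (1 : LSite (F.P K).d → Fin (F.P K).d → (Matrix (Fin 2) (Fin 2) ℂ)ˣ) := by
    funext z κ; rw [B10Eq27TorusAxialLog.pull_apply, bgUnits_one]; rfl
  rw [h1, wrec_one_left]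

/-- Along a ray `t ↦ t•X` the pulled-back exponent is `t • X♯`. [folklore] -/
theorem pullExp_smul (X : PBond (F.P K) 0 → Matrix (Fin 2) (Fin 2) ℂ) (t : ℂ) :
    (fun z κ => (t • X) ⟨transl (basePt F n K) z, κ⟩) = t • (fun z κ => X ⟨transl (basePt F n K) z, κ⟩ : LSite (F.P K).d → Fin (F.P K).d → Matrix (Fin 2) (Fin 2) ℂ) := by
  funext z κ; rfl

/-- ★★ **THE FLAT FRAMES ARE DIFFERENTIABLE AT `A = 0` — NO REGULARITY HYPOTHESIS** (the flat background satisfies every window: lit ✓`analyticAt_vprodQ` at `b := 0`, and `v = w` on the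
Prop.-4 ball `8C₁L^{K−n}‖A‖ ≤ 1` around `0`, ✓`vprod_eq_vprodQ`). [cite: Balaban1985Averaging, Prop. 6 p.43, p.42, (160) p.42] -/
theorem differentiableAt_frameTw_one (y : Site (F.P n) 0) :
    DifferentiableAt ℂ (fun A : PBond (F.P K) 0 → Matrix (Fin 2) (Fin 2) ℂ => ((frameTw F n K h 1 A y : (Matrix (Fin 2) (Fin 2) ℂ)ˣ) : Matrix (Fin 2) (Fin 2) ℂ)) 0 := by
  have hL2 : 2 ≤ (F.P K).L := (F.P K).hL.2
  have hd : (F.P K).d = 3 := T3Family.P_d F K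
  have hC1 := C1_pos (F.P K).d
  set Bf : (PBond (F.P K) 0 → Matrix (Fin 2) (Fin 2) ℂ) → LSite (F.P K).d → Fin (F.P K).d → Matrix (Fin 2) (Fin 2) ℂ :=
    fun A z κ => A ⟨transl (basePt F n K) z, κ⟩ with hBf
  have hBa : ∀ z κ, AnalyticAt ℂ (fun A : PBond (F.P K) 0 → Matrix (Fin 2) (Fin 2) ℂ => Bf A z κ) 0 := fun z κ =>
    (ContinuousLinearMap.proj (R := ℂ) (φ := fun _ : PBond (F.P K) 0 => Matrix (Fin 2) (Fin 2) ℂ) (⟨transl (basePt F n K) z, κ⟩ : PBond (F.P K) 0)).analyticAt 0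
  have hB0 : ∀ z κ, ‖Bf 0 z κ‖ ≤ 0 := fun z κ => by rw [hBf]; simp
  have hk0 : 8 * C1 (F.P K).d * ((((F.P K).L : ℝ)) ^ (K - n) * 0) ≤ 1 := by rw [mul_zero, mul_zero]; norm_num
  have κ₀ : Fin (F.P K).d := Fin.cast hd.symm 0
  have hvQ := (analyticAt_vprodQ (E := PBond (F.P K) 0 → Matrix (Fin 2) (Fin 2) ℂ) (F.P K).L hL2 Bf hBa le_rfl hB0 (K - n) hk0 κ₀ (K - n) le_rfl
    (coordT3 F n K h y)).1
  -- near `0`, `frameTw 1 = vprodQ ∘ ♯`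
  have hev : (fun A : PBond (F.P K) 0 → Matrix (Fin 2) (Fin 2) ℂ =>
        ((vprodQ (F.P K).L (Bf A) (K - n) (coordT3 F n K h y) : (Matrix (Fin 2) (Fin 2) ℂ)ˣ) : Matrix (Fin 2) (Fin 2) ℂ))
      =ᶠ[𝓝 0] fun A => ((frameTw F n K h 1 A y : (Matrix (Fin 2) (Fin 2) ℂ)ˣ) : Matrix (Fin 2) (Fin 2) ℂ) := by
    set ρ : ℝ := 1 / ((8 * C1 (F.P K).d + 1) * (((F.P K).L : ℝ) ^ (K - n) + 1)) with hρ
    have hρ0 : 0 < ρ := by rw [hρ]; positivity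
    rw [Filter.EventuallyEq, Metric.eventually_nhds_iff]
    refine ⟨ρ, hρ0, fun A hA => ?_⟩
    rw [dist_zero_right] at hA
    have hA0 : 0 ≤ ‖A‖ := norm_nonneg A
    have hM0 : 0 ≤ ((F.P K).L : ℝ) ^ (K - n) := by positivity
    have hprod : (8 * C1 (F.P K).d + 1) * (((F.P K).L : ℝ) ^ (K - n) + 1) * ‖A‖ ≤ 1 := by
      have hpos : 0 < (8 * C1 (F.P K).d + 1) * (((F.P K).L : ℝ) ^ (K - n) + 1) := by positivity
      have := mul_le_mul_of_nonneg_left hA.le hpos.le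
      rwa [hρ, mul_one_div_cancel hpos.ne'] at this
    have hsmall : 8 * C1 (F.P K).d * (((F.P K).L : ℝ) ^ (K - n) * ‖A‖) ≤ 1 := by
      nlinarith [hC1.le, hM0, hA0, mul_nonneg hM0 hA0, mul_nonneg hC1.le hA0]
    show ((vprodQ (F.P K).L (Bf A) (K - n) (coordT3 F n K h y) : (Matrix (Fin 2) (Fin 2) ℂ)ˣ) : Matrix (Fin 2) (Fin 2) ℂ)
      = ((frameTw F n K h 1 A y : (Matrix (Fin 2) (Fin 2) ℂ)ˣ) : Matrix (Fin 2) (Fin 2) ℂ)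
    rw [frameTw_one_eq_vprod, vprod_eq_vprodQ (F.P K).L hL2 (Bf A) (norm_nonneg A) (fun z κ => norm_pullExp_le F A (basePt F n K) z κ) (K - n) hsmall (K - n) le_rfl]
  exact (hvQ.congr hev).differentiableAt

/-- ★★ `hr` AT THE FLAT MEMBER, UNCONDITIONALLY: `HasFDerivAt (A ↦ frameTw 1 A y) (fderiv … 0) 0`. [cite: Balaban1985Averaging, Prop. 6 p.43, (160) p.42] -/
theorem hasFDerivAt_frameTw_one (y : Site (F.P n) 0) :
    HasFDerivAt (fun A : PBond (F.P K) 0 → Matrix (Fin 2) (Fin 2) ℂ => ((frameTw F n K h 1 A y : (Matrix (Fin 2) (Fin 2) ℂ)ˣ) : Matrix (Fin 2) (Fin 2) ℂ))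
      (fderiv ℂ (fun A : PBond (F.P K) 0 → Matrix (Fin 2) (Fin 2) ℂ => ((frameTw F n K h 1 A y : (Matrix (Fin 2) (Fin 2) ℂ)ˣ) : Matrix (Fin 2) (Fin 2) ℂ)) 0) 0 :=
  (differentiableAt_frameTw_one F h y).hasFDerivAt

/-- ★★★ **THE FLAT FRAME RESPONSE `r(1)` AT THE MEMBER, EXPLICIT**: for every direction `X` on the fine bonds,
`r(1) X (y) := fderiv ℂ (A ↦ frameTw 1 A y) 0 X = Σ_{j<K−n} F̂(L^{K−n−j}·ŷ)[L^j·Q_j(1)X♯]`, `X♯ z κ = X⟨x₀ + z, κ⟩`, `ŷ = coordT3 y` — the derivative along the ray `t ↦ tX`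
(chain rule) equals §2's formula (uniqueness of the derivative). [cite: Balaban1985Averaging, (160)–(163) p.42, (110)–(112) p.34, (125)–(127) pp.36–37; Balaban1985BackgroundPropagators, (3.14) p.393] -/
theorem fderiv_frameTw_one_apply (y : Site (F.P n) 0) (X : PBond (F.P K) 0 → Matrix (Fin 2) (Fin 2) ℂ) :
    fderiv ℂ (fun A : PBond (F.P K) 0 → Matrix (Fin 2) (Fin 2) ℂ => ((frameTw F n K h 1 A y : (Matrix (Fin 2) (Fin 2) ℂ)ˣ) : Matrix (Fin 2) (Fin 2) ℂ)) 0 X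
      = ∑ j ∈ Finset.range (K - n), Fhat (F.P K).L (linQIter (F.P K).L (fun z κ => X ⟨transl (basePt F n K) z, κ⟩) j)
          ((((F.P K).L : ℤ) ^ (K - n - j)) • coordT3 F n K h y) := by
  have hL2 : 2 ≤ (F.P K).L := (F.P K).hL.2
  -- the ray derivative from the Fréchet derivative
  have hF := hasFDerivAt_frameTw_one F h y
  have hray : HasDerivAt (fun t : ℂ => ((frameTw F n K h 1 (t • X) y : (Matrix (Fin 2) (Fin 2) ℂ)ˣ) : Matrix (Fin 2) (Fin 2) ℂ))
      (fderiv ℂ (fun A : PBond (F.P K) 0 → Matrix (Fin 2) (Fin 2) ℂ => ((frameTw F n K h 1 A y : (Matrix (Fin 2) (Fin 2) ℂ)ˣ) : Matrix (Fin 2) (Fin 2) ℂ)) 0 X) 0 := by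
    have hline : HasDerivAt (fun t : ℂ => t • X) X 0 := by
      simpa using (hasDerivAt_id (0 : ℂ)).smul_const X
    have hF0 : HasFDerivAt (fun A : PBond (F.P K) 0 → Matrix (Fin 2) (Fin 2) ℂ => ((frameTw F n K h 1 A y : (Matrix (Fin 2) (Fin 2) ℂ)ˣ) : Matrix (Fin 2) (Fin 2) ℂ))
        (fderiv ℂ (fun A : PBond (F.P K) 0 → Matrix (Fin 2) (Fin 2) ℂ => ((frameTw F n K h 1 A y : (Matrix (Fin 2) (Fin 2) ℂ)ˣ) : Matrix (Fin 2) (Fin 2) ℂ)) 0) ((0 : ℂ) • X) := by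
      rw [zero_smul]; exact hF
    exact hF0.comp_hasDerivAt (0 : ℂ) hline
  -- the ray derivative from §2
  have hray' : HasDerivAt (fun t : ℂ => ((frameTw F n K h 1 (t • X) y : (Matrix (Fin 2) (Fin 2) ℂ)ˣ) : Matrix (Fin 2) (Fin 2) ℂ))
      (∑ j ∈ Finset.range (K - n), Fhat (F.P K).L (linQIter (F.P K).L (fun z κ => X ⟨transl (basePt F n K) z, κ⟩) j)
          ((((F.P K).L : ℤ) ^ (K - n - j)) • coordT3 F n K h y)) 0 := by
    have hfun : (fun t : ℂ => ((frameTw F n K h 1 (t • X) y : (Matrix (Fin 2) (Fin 2) ℂ)ˣ) : Matrix (Fin 2) (Fin 2) ℂ))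
        = fun t : ℂ => ((vprod (F.P K).L (expCfg (t • (fun z κ => X ⟨transl (basePt F n K) z, κ⟩ : LSite (F.P K).d → Fin (F.P K).d → Matrix (Fin 2) (Fin 2) ℂ)))
            (K - n) (coordT3 F n K h y) : (Matrix (Fin 2) (Fin 2) ℂ)ˣ) : Matrix (Fin 2) (Fin 2) ℂ) := by
      funext t; rw [frameTw_one_eq_vprod, pullExp_smul]
    rw [hfun]
    exact hasDerivAt_vprod_expCfg_smul (F.P K).L hL2 _ (norm_nonneg X) (fun z κ => norm_pullExp_le F X (basePt F n K) z κ) (K - n) (coordT3 F n K h y)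
  exact hray.unique hray'

/-- ★ **THE SUP ROW OF `r(1)` AT THE MEMBER** — RULING g26-№1 (3c)'s «`‖rX‖ ≲ d·L^{K−n}‖X‖`» at the flat background, explicit: `‖r(1) X (y)‖ ≤ 2·3·L^{K−n}·‖X‖` (`d = 3`; §3 at
`b := ‖X‖`). [cite: Balaban1985Averaging, (163) p.42] -/
theorem norm_fderiv_frameTw_one_apply_le (y : Site (F.P n) 0) (X : PBond (F.P K) 0 → Matrix (Fin 2) (Fin 2) ℂ) :
    ‖fderiv ℂ (fun A : PBond (F.P K) 0 → Matrix (Fin 2) (Fin 2) ℂ => ((frameTw F n K h 1 A y : (Matrix (Fin 2) (Fin 2) ℂ)ˣ) : Matrix (Fin 2) (Fin 2) ℂ)) 0 X‖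
      ≤ 2 * 3 * ((F.P K).L : ℝ) ^ (K - n) * ‖X‖ := by
  have hL2 : 2 ≤ (F.P K).L := (F.P K).hL.2
  have hd : (F.P K).d = 3 := T3Family.P_d F K
  rw [fderiv_frameTw_one_apply]
  have h := norm_frameResponse_le (F.P K).L hL2 (fun z κ => X ⟨transl (basePt F n K) z, κ⟩) (norm_nonneg X) (fun z κ => norm_pullExp_le F X (basePt F n K) z κ)
    (K - n) (coordT3 F n K h y)
  have hd' : (((F.P K).d : ℕ) : ℝ) = 3 := by exact_mod_cast hd
  rwa [hd'] at h

end Member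

end Summit.QuantumFields.YangMills.Theorems.Prop7FlatFrameResponse

end
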